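import Mathlib
import Summits.ValiantsHypothesis.ValiantsHypothesis.Theorems.NewtonUnitEquationsTwoProductsRadixResidueOff
import Summits.ValiantsHypothesis.ValiantsHypothesis.Theorems.NewtonUnitEquationsTwoProductsRadix
import Summits.ValiantsHypothesis.ValiantsHypothesis.Theorems.NewtonUnitEquationsTwoProductsRadixClassMin
import Summits.ValiantsHypothesis.ValiantsHypothesis.Theorems.NewtonUnitEquationsTwoProductsRadixCosetOn
import Summits.ValiantsHypothesis.ValiantsHypothesis.Theorems.NewtonUnitEquationsTwoProductsRadixClassTransport

/-!
# Pinned rigid radix products: stub 7g at `m = 0` on radix frames, affine in `|L|` (lead c6, crux TwoProducts)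
`L`-pinned support points of `∏_{i<k} expand (M^i) φ_i` number `≤ T + |L|·k(b+kq)²t` (generalised first factor): classes `mod M`
not meeting `L` give letters (`stub_radixClassMin`), classes meeting `L` are transported to the smaller instance `ψ · C`
(`stub_radixCosetOn`, `stub_radixClassTransport`); the induction on scales is AFFINE in `|L|`.
-/

set_option linter.dupNamespace false

namespace Summit.ValiantsHypothesis.ValiantsHypothesis.Theorems.TwoProducts.PinnedRadix

open scoped BigOperators Pointwise Classical
open MvPolynomial

noncomputable section

/-! ## Residue classes -/

/-- Support points of `F · expand M C` have the residue class of a letter of `F` dominated by them. -/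
theorem exists_letter_of_mem_support {M : ℕ} (hM : 1 ≤ M) (F C : MvPolynomial (Fin 2) ℂ)
    {e : Fin 2 →₀ ℕ} (he : e ∈ (F * expand M C).support) :
    ∃ a ∈ F.support, (((a : Fin 2 →₀ ℕ) 0 % M, (a : Fin 2 →₀ ℕ) 1 % M) : ℕ × ℕ) = (((e : Fin 2 →₀ ℕ) 0 % M, (e : Fin 2 →₀ ℕ) 1 % M) : ℕ × ℕ) ∧ a ≤ e := by
  rw [mem_support_iff, coeff_mul] at he
  obtain ⟨x, hx, hne⟩ := Finset.exists_ne_zero_of_sum_ne_zero he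
  obtain ⟨ha, b, -, hb⟩ := RadixResidueOff.term_ne_zero (by omega) F C x hne
  have hxe : x.1 + x.2 = e := Finset.HasAntidiagonal.mem_antidiagonal.1 hx
  refine ⟨x.1, mem_support_iff.2 ha, ?_, ?_⟩
  · rw [← hxe, hb]
    simp only [RadixResidueOff.mod_add_smul_apply]
  · rw [← hxe]
    exact le_self_add

/-- Adding `M •` anything does not change the residue class. -/
theorem kap_add_smul (M : ℕ) (s c : Fin 2 →₀ ℕ) : (((s + M • c : Fin 2 →₀ ℕ) 0 % M, (s + M • c : Fin 2 →₀ ℕ) 1 % M) : ℕ × ℕ) = (((s : Fin 2 →₀ ℕ) 0 % M, (s : Fin 2 →₀ ℕ) 1 % M) : ℕ × ℕ) := by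
  simp only [RadixResidueOff.mod_add_smul_apply]

/-- CLASS DATA.  For a residue class containing letters of `F`: a base point `s` (componentwise minimum of the class letters) and
the polynomial `ψ` collecting `F` on the coset `s + M·ℕ²`, with the bookkeeping facts the induction needs. -/
theorem exists_class_data {M : ℕ} (hM : 1 ≤ M) (F : MvPolynomial (Fin 2) ℂ) (r : ℕ × ℕ)
    (hr : ∃ a ∈ F.support, (((a : Fin 2 →₀ ℕ) 0 % M, (a : Fin 2 →₀ ℕ) 1 % M) : ℕ × ℕ) = r) :
    ∃ (s : Fin 2 →₀ ℕ) (ψ : MvPolynomial (Fin 2) ℂ), (((s : Fin 2 →₀ ℕ) 0 % M, (s : Fin 2 →₀ ℕ) 1 % M) : ℕ × ℕ) = r ∧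
      (∀ c : Fin 2 →₀ ℕ, coeff c ψ = coeff (s + M • c) F) ∧
      (∀ d ∈ F.support, d 0 % M = s 0 % M → d 1 % M = s 1 % M → s ≤ d) ∧
      (∀ c ∈ ψ.support, s + M • c ∈ F.support) := by
  obtain ⟨r1, r2⟩ := r
  set T : Finset (Fin 2 →₀ ℕ) := F.support.filter (fun a => (((a : Fin 2 →₀ ℕ) 0 % M, (a : Fin 2 →₀ ℕ) 1 % M) : ℕ × ℕ) = (r1, r2)) with hT
  have hTne : T.Nonempty := by
    obtain ⟨a, ha, har⟩ := hr
    exact ⟨a, Finset.mem_filter.2 ⟨ha, har⟩⟩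
  set x0 : ℕ := T.inf' hTne (fun a => a 0) with hx0
  set x1 : ℕ := T.inf' hTne (fun a => a 1) with hx1
  set s : Fin 2 →₀ ℕ := Finsupp.single 0 x0 + Finsupp.single 1 x1 with hs
  have hs0 : s 0 = x0 := by simp [hs]
  have hs1 : s 1 = x1 := by simp [hs]
  have hmemT : ∀ a ∈ T, a ∈ F.support ∧ (((a : Fin 2 →₀ ℕ) 0 % M, (a : Fin 2 →₀ ℕ) 1 % M) : ℕ × ℕ) = (r1, r2) := fun a ha => Finset.mem_filter.1 ha
  have hkap : (((s : Fin 2 →₀ ℕ) 0 % M, (s : Fin 2 →₀ ℕ) 1 % M) : ℕ × ℕ) = (r1, r2) := by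
    obtain ⟨a0, ha0, hax0⟩ := Finset.exists_mem_eq_inf' hTne (fun a => a 0)
    obtain ⟨a1, ha1, hax1⟩ := Finset.exists_mem_eq_inf' hTne (fun a => a 1)
    have h0 := (hmemT a0 ha0).2
    have h1 := (hmemT a1 ha1).2
    simp only [Prod.mk.injEq] at h0 h1 ⊢
    refine ⟨?_, ?_⟩
    · rw [hs0, hx0, hax0]; exact h0.1
    · rw [hs1, hx1, hax1]; exact h1.2
  have hdom : ∀ d ∈ F.support, d 0 % M = s 0 % M → d 1 % M = s 1 % M → s ≤ d := by
    intro d hd h0 h1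
    have hdT : d ∈ T := by
      refine Finset.mem_filter.2 ⟨hd, ?_⟩
      rw [← hkap]
      simp only [Prod.mk.injEq]
      exact ⟨h0, h1⟩
    intro i
    fin_cases i
    · show s 0 ≤ d 0
      rw [hs0, hx0]; exact Finset.inf'_le _ hdT
    · show s 1 ≤ d 1
      rw [hs1, hx1]; exact Finset.inf'_le _ hdT
  set ψ : MvPolynomial (Fin 2) ℂ :=
    ∑ c ∈ T.image (fun d => (Finsupp.mapRange (· / M) (Nat.zero_div M) (d - s) : Fin 2 →₀ ℕ)), monomial c (coeff (s + M • c) F) with hψ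
  have hcoeff : ∀ c : Fin 2 →₀ ℕ, coeff c ψ = coeff (s + M • c) F := by
    intro c
    rw [hψ, coeff_sum]
    simp only [coeff_monomial]
    rw [Finset.sum_ite_eq']
    split_ifs with h
    · rfl
    · symm
      by_contra hne
      apply h
      have hd : s + M • c ∈ F.support := mem_support_iff.2 hne
      have hdT : s + M • c ∈ T := by
        refine Finset.mem_filter.2 ⟨hd, ?_⟩
        rw [kap_add_smul, hkap]
      refine Finset.mem_image.2 ⟨s + M • c, hdT, ?_⟩
      ext i
      simp [Nat.mul_div_cancel_left _ hM]
  refine ⟨s, ψ, hkap, hcoeff, hdom, ?_⟩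
  intro c hc
  rw [mem_support_iff, hcoeff] at hc
  exact mem_support_iff.2 hc

/-! ## One residue class: transport and counting -/

/-- Pinned Finsets are subsets of the support. -/
theorem pinf_subset (P : MvPolynomial (Fin 2) ℂ) (L : Finset (Fin 2 →₀ ℕ)) : (Finset.filter (fun e : Fin 2 →₀ ℕ => ∃ w : Fin 2 → ℤ, 0 < w 0 ∧ 0 < w 1 ∧ ∀ q ∈ MvPolynomial.support (P), q ≠ e → ((w) 0 * ((q : Fin 2 →₀ ℕ) 0 : ℤ) + (w) 1 * ((q : Fin 2 →₀ ℕ) 1 : ℤ)) ≤ ((w) 0 * ((e : Fin 2 →₀ ℕ) 0 : ℤ) + (w) 1 * ((e : Fin 2 →₀ ℕ) 1 : ℤ)) → q ∈ ((L) : Finset (Fin 2 →₀ ℕ))) (MvPolynomial.support (P))) ⊆ P.support :=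
  Finset.filter_subset _ _

/-- ONE CLASS.  With class data `(s, ψ)` for the class `r`, the `L`-pinned points of `F · expand M C` in class `r` inject into the
`L_s`-pinned points of `ψ · C`, `L_s = {(l − s)/M : l ∈ L, l in class r, s ≤ l}`. -/
theorem card_class_le {M : ℕ} (hM : 1 ≤ M) (F ψ C : MvPolynomial (Fin 2) ℂ) (s : Fin 2 →₀ ℕ) (r : ℕ × ℕ)
    (L : Finset (Fin 2 →₀ ℕ)) (hks : (((s : Fin 2 →₀ ℕ) 0 % M, (s : Fin 2 →₀ ℕ) 1 % M) : ℕ × ℕ) = r)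
    (hcoeff : ∀ c : Fin 2 →₀ ℕ, coeff c ψ = coeff (s + M • c) F)
    (hdom : ∀ d ∈ F.support, d 0 % M = s 0 % M → d 1 % M = s 1 % M → s ≤ d) :
    (((Finset.filter (fun e : Fin 2 →₀ ℕ => ∃ w : Fin 2 → ℤ, 0 < w 0 ∧ 0 < w 1 ∧ ∀ q ∈ MvPolynomial.support (F * expand M C), q ≠ e → ((w) 0 * ((q : Fin 2 →₀ ℕ) 0 : ℤ) + (w) 1 * ((q : Fin 2 →₀ ℕ) 1 : ℤ)) ≤ ((w) 0 * ((e : Fin 2 →₀ ℕ) 0 : ℤ) + (w) 1 * ((e : Fin 2 →₀ ℕ) 1 : ℤ)) → q ∈ ((L) : Finset (Fin 2 →₀ ℕ))) (MvPolynomial.support (F * expand M C)))).filter (fun e => (((e : Fin 2 →₀ ℕ) 0 % M, (e : Fin 2 →₀ ℕ) 1 % M) : ℕ × ℕ) = r)).card ≤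
      ((Finset.filter (fun e : Fin 2 →₀ ℕ => ∃ w : Fin 2 → ℤ, 0 < w 0 ∧ 0 < w 1 ∧ ∀ q ∈ MvPolynomial.support (ψ * C), q ≠ e → ((w) 0 * ((q : Fin 2 →₀ ℕ) 0 : ℤ) + (w) 1 * ((q : Fin 2 →₀ ℕ) 1 : ℤ)) ≤ ((w) 0 * ((e : Fin 2 →₀ ℕ) 0 : ℤ) + (w) 1 * ((e : Fin 2 →₀ ℕ) 1 : ℤ)) → q ∈ (((L.filter (fun l => (((l : Fin 2 →₀ ℕ) 0 % M, (l : Fin 2 →₀ ℕ) 1 % M) : ℕ × ℕ) = r ∧ s ≤ l)).image (fun l => (Finsupp.mapRange (· / M) (Nat.zero_div M) (l - s) : Fin 2 →₀ ℕ))) : Finset (Fin 2 →₀ ℕ))) (MvPolynomial.support (ψ * C)))).card := by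
  have hid : ∀ p : Fin 2 →₀ ℕ, coeff (s + M • p) (F * expand M C) = coeff p (ψ * C) :=
    RadixCosetOn.stub_radixCosetOn M F ψ C s hM hcoeff hdom
  have hdomP : ∀ e ∈ (F * expand M C).support, e 0 % M = s 0 % M → e 1 % M = s 1 % M → s ≤ e := by
    intro e he h0 h1
    obtain ⟨a, ha, hka, hale⟩ := exists_letter_of_mem_support hM F C he
    have hka' : a 0 % M = s 0 % M ∧ a 1 % M = s 1 % M := by
      simp only [Prod.mk.injEq] at hka
      exact ⟨hka.1.trans h0, hka.2.trans h1⟩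
    exact (hdom a ha hka'.1 hka'.2).trans hale
  set Ls := (L.filter (fun l => (((l : Fin 2 →₀ ℕ) 0 % M, (l : Fin 2 →₀ ℕ) 1 % M) : ℕ × ℕ) = r ∧ s ≤ l)).image (fun l => (Finsupp.mapRange (· / M) (Nat.zero_div M) (l - s) : Fin 2 →₀ ℕ)) with hLs
  refine Finset.card_le_card_of_injOn (fun e => (Finsupp.mapRange (· / M) (Nat.zero_div M) (e - s) : Fin 2 →₀ ℕ)) ?_ ?_
  · intro e he
    rw [Finset.mem_coe, Finset.mem_filter] at he
    obtain ⟨he, hker⟩ := he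
    rw [Finset.mem_filter] at he
    obtain ⟨heP, w, hw0, hw1, hpin⟩ := he
    have hes : e 0 % M = s 0 % M ∧ e 1 % M = s 1 % M := by
      rw [← hks] at hker
      simp only [Prod.mk.injEq] at hker
      exact hker
    obtain ⟨p, hep, hp, hcomp⟩ := RadixClassTransport.stub_radixClassTransport M F ψ C s L hM hid hdomP w hw0 hw1 e heP
      hes.1 hes.2 hpin
    have hediv : (Finsupp.mapRange (· / M) (Nat.zero_div M) (e - s) : Fin 2 →₀ ℕ) = p := by
      rw [hep, add_tsub_cancel_left]
      exact Radix.ediv_smul hM p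
    rw [Finset.mem_coe]
    simp only [hediv]
    refine Finset.mem_filter.2 ⟨hp, w, hw0, hw1, ?_⟩
    intro q' hq' hne hle
    have hl : s + M • q' ∈ L := hcomp q' hq' hne hle
    refine Finset.mem_image.2 ⟨s + M • q', Finset.mem_filter.2 ⟨hl, ?_, le_self_add⟩, ?_⟩
    · rw [kap_add_smul, hks]
    · rw [add_tsub_cancel_left]; exact Radix.ediv_smul hM q'
  · intro e₁ he₁ e₂ he₂ heq
    rw [Finset.mem_coe, Finset.mem_filter] at he₁ he₂
    have key : ∀ e ∈ (Finset.filter (fun e : Fin 2 →₀ ℕ => ∃ w : Fin 2 → ℤ, 0 < w 0 ∧ 0 < w 1 ∧ ∀ q ∈ MvPolynomial.support (F * expand M C), q ≠ e → ((w) 0 * ((q : Fin 2 →₀ ℕ) 0 : ℤ) + (w) 1 * ((q : Fin 2 →₀ ℕ) 1 : ℤ)) ≤ ((w) 0 * ((e : Fin 2 →₀ ℕ) 0 : ℤ) + (w) 1 * ((e : Fin 2 →₀ ℕ) 1 : ℤ)) → q ∈ ((L) : Finset (Fin 2 →₀ ℕ))) (MvPolynomial.support (F * expand M C))), (((e : Fin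 2 →₀ ℕ) 0 % M, (e : Fin 2 →₀ ℕ) 1 % M) : ℕ × ℕ) = r → e = s + M • (Finsupp.mapRange (· / M) (Nat.zero_div M) (e - s) : Fin 2 →₀ ℕ) := by
      intro e he hker
      have heP : e ∈ (F * expand M C).support := pinf_subset _ _ he
      rw [← hks] at hker
      simp only [Prod.mk.injEq] at hker
      exact RadixClassTransport.eq_add_smul_of_mod_eq hker.1 hker.2 (hdomP e heP hker.1 hker.2)
    have h1 := key e₁ he₁.1 he₁.2
    have h2 := key e₂ he₂.1 he₂.2
    have heq' : (Finsupp.mapRange (· / M) (Nat.zero_div M) (e₁ - s) : Fin 2 →₀ ℕ) = (Finsupp.mapRange (· / M) (Nat.zero_div M) (e₂ - s) : Fin 2 →₀ ℕ) := heq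
    rw [h1, h2, heq']

/-- EMPTY CLASSES.  A pinned point whose class meets no point of `L` is a letter of `F` (class-minimiser lemma). -/
theorem mem_support_of_class_not_mem {M : ℕ} (hM : 1 ≤ M) (F C : MvPolynomial (Fin 2) ℂ) (hC : coeff 0 C ≠ 0)
    (L : Finset (Fin 2 →₀ ℕ)) {e : Fin 2 →₀ ℕ} (he : e ∈ (Finset.filter (fun e : Fin 2 →₀ ℕ => ∃ w : Fin 2 → ℤ, 0 < w 0 ∧ 0 < w 1 ∧ ∀ q ∈ MvPolynomial.support (F * expand M C), q ≠ e → ((w) 0 * ((q : Fin 2 →₀ ℕ) 0 : ℤ) + (w) 1 * ((q : Fin 2 →₀ ℕ) 1 : ℤ)) ≤ ((w) 0 * ((e : Fin 2 →₀ ℕ) 0 : ℤ) + (w) 1 * ((e : Fin 2 →₀ ℕ) 1 : ℤ)) → q ∈ ((L) : Finset (Fin 2 →₀ ℕ))) (MvPolynomial.support (F * expand M C))))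
    (hnot : (((e : Fin 2 →₀ ℕ) 0 % M, (e : Fin 2 →₀ ℕ) 1 % M) : ℕ × ℕ) ∉ L.image (fun l => (((l : Fin 2 →₀ ℕ) 0 % M, (l : Fin 2 →₀ ℕ) 1 % M) : ℕ × ℕ))) : e ∈ F.support := by
  rw [Finset.mem_filter] at he
  obtain ⟨heP, w, hw0, hw1, hpin⟩ := he
  refine RadixClassMin.stub_radixClassMin M F C hM hC w hw0 hw1 e heP ?_
  intro q hq hne h0 h1
  by_contra hle
  push Not at hle
  have hqL : q ∈ L := hpin q hq hne hle
  apply hnot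
  refine Finset.mem_image.2 ⟨q, hqL, ?_⟩
  simp only [Prod.mk.injEq]
  exact ⟨h0, h1⟩

/-! ## The affine induction on the number of scales -/

/-- GENERALISED AFFINE BOUND: first factor `F` with `≤ T` monomials in the box `[0, bM)²`, then `k` scales of digit polynomials
(`≤ t` monomials, box `[0, qM)²`, constant terms `1`), any `L`:
`#(Finset.filter (fun e : Fin 2 →₀ ℕ => ∃ w : Fin 2 → ℤ, 0 < w 0 ∧ 0 < w 1 ∧ ∀ q ∈ MvPolynomial.support (F · expand M (∏_{i<k} expand (M^i) φ_i)), q ≠ e → ((w) 0 * ((q : Fin 2 →₀ ℕ) 0 : ℤ) + (w) 1 * ((q : Fin 2 →₀ ℕ) 1 : ℤ)) ≤ ((w) 0 * ((e : Fin 2 →₀ ℕ) 0 : ℤ) + (w) 1 * ((e : Fin 2 →₀ ℕ) 1 : ℤ)) → q ∈ ((L) : Finset (Fin 2 →₀ ℕ))) (MvPolynomial.support (F · expand M (∏_{i<k} expand (M^i) φ_i)))) ≤ T + |L|·k(b + kq)²t`. -/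
theorem genPin : ∀ (k M q t T b : ℕ) (F : MvPolynomial (Fin 2) ℂ)
    (φ : Fin k → MvPolynomial (Fin 2) ℂ) (L : Finset (Fin 2 →₀ ℕ)), 1 ≤ M → F.support.card ≤ T →
    (∀ e ∈ F.support, e 0 < b * M ∧ e 1 < b * M) →
    (∀ i, coeff 0 (φ i) = 1) → (∀ i, (φ i).support.card ≤ t) →
    (∀ i, ∀ e ∈ (φ i).support, e 0 < q * M ∧ e 1 < q * M) →
    ((Finset.filter (fun e : Fin 2 →₀ ℕ => ∃ w : Fin 2 → ℤ, 0 < w 0 ∧ 0 < w 1 ∧ ∀ q ∈ MvPolynomial.support (F * expand M (∏ i : Fin k, expand (M ^ (i : ℕ)) (φ i))), q ≠ e → ((w) 0 * ((q : Fin 2 →₀ ℕ) 0 : ℤ) + (w) 1 * ((q : Fin 2 →₀ ℕ) 1 : ℤ)) ≤ ((w) 0 * ((e : Fin 2 →₀ ℕ) 0 : ℤ) + (w) 1 * ((e : Fin 2 →₀ ℕ) 1 : ℤ)) → q ∈ ((L) : Finset (Fin 2 →₀ ℕ))) (MvPolynomial.support (F * expand M (∏ i : Fin k, expand (M ^ (i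 : ℕ)) (φ i)))))).card ≤ T + L.card * (k * (b + k * q) ^ 2 * t) := by
  intro k
  induction k with
  | zero =>
    intro M q t T b F φ L _ hT _ _ _ _
    simp only [Finset.univ_eq_empty, Finset.prod_empty, map_one, mul_one, zero_mul, mul_zero, add_zero]
    exact (Finset.card_le_card (pinf_subset F L)).trans hT
  | succ k ih =>
    intro M q t T b F φ L hM hT hFbox hφ0 hφt hφbox
    rw [Radix.prod_expand_succ]
    set C' : MvPolynomial (Fin 2) ℂ := ∏ i : Fin k, expand (M ^ (i : ℕ)) (φ i.succ) with hC'
    set C : MvPolynomial (Fin 2) ℂ := φ 0 * expand M C' with hCdef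
    have hC'0 : coeff 0 C' = 1 := Radix.coeff_zero_prod_expand hM _ (fun i => hφ0 i.succ)
    have hC0 : coeff 0 C = 1 := by
      rw [hCdef, ← constantCoeff_eq, map_mul, constantCoeff_eq, hφ0 0, Radix.coeff_zero_expand_of_pos hM, hC'0, mul_one]
    have hC0' : coeff 0 C ≠ 0 := by rw [hC0]; exact one_ne_zero
    set Pin := (Finset.filter (fun e : Fin 2 →₀ ℕ => ∃ w : Fin 2 → ℤ, 0 < w 0 ∧ 0 < w 1 ∧ ∀ q ∈ MvPolynomial.support (F * expand M C), q ≠ e → ((w) 0 * ((q : Fin 2 →₀ ℕ) 0 : ℤ) + (w) 1 * ((q : Fin 2 →₀ ℕ) 1 : ℤ)) ≤ ((w) 0 * ((e : Fin 2 →₀ ℕ) 0 : ℤ) + (w) 1 * ((e : Fin 2 →₀ ℕ) 1 : ℤ)) → q ∈ ((L) : Finset (Fin 2 →₀ ℕ))) (MvPolynomial.support (F * expand M C))) with hPin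
    set Limg : Finset (ℕ × ℕ) := L.image (fun l => (((l : Fin 2 →₀ ℕ) 0 % M, (l : Fin 2 →₀ ℕ) 1 % M) : ℕ × ℕ)) with hLimg
    set A := Pin.filter (fun e => (((e : Fin 2 →₀ ℕ) 0 % M, (e : Fin 2 →₀ ℕ) 1 % M) : ℕ × ℕ) ∉ Limg) with hA
    set B := Pin.filter (fun e => (((e : Fin 2 →₀ ℕ) 0 % M, (e : Fin 2 →₀ ℕ) 1 % M) : ℕ × ℕ) ∈ Limg) with hB
    have hsplit : Pin.card = B.card + A.card := by
      rw [hA, hB]; exact (Finset.card_filter_add_card_filter_not _).symm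
    have hAle : A.card ≤ T := by
      refine le_trans (Finset.card_le_card ?_) hT
      intro e he
      rw [hA, Finset.mem_filter] at he
      exact mem_support_of_class_not_mem hM F C hC0' L he.1 he.2
    have hBsum : B.card = ∑ r ∈ Limg, (B.filter (fun e => (((e : Fin 2 →₀ ℕ) 0 % M, (e : Fin 2 →₀ ℕ) 1 % M) : ℕ × ℕ) = r)).card :=
      Finset.card_eq_sum_card_fiberwise (fun e he => by
        have he' := Finset.mem_coe.1 he
        rw [hB, Finset.mem_filter] at he'
        exact Finset.mem_coe.2 he'.2)
    set Y' : ℕ := k * (b + q + k * q) ^ 2 * t with hY'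
    have hfibre : ∀ r ∈ Limg, (B.filter (fun e => (((e : Fin 2 →₀ ℕ) 0 % M, (e : Fin 2 →₀ ℕ) 1 % M) : ℕ × ℕ) = r)).card ≤
        b * b * t + (L.filter (fun l => (((l : Fin 2 →₀ ℕ) 0 % M, (l : Fin 2 →₀ ℕ) 1 % M) : ℕ × ℕ) = r)).card * Y' := by
      intro r _
      by_cases hr : ∃ a ∈ F.support, (((a : Fin 2 →₀ ℕ) 0 % M, (a : Fin 2 →₀ ℕ) 1 % M) : ℕ × ℕ) = r
      · obtain ⟨s, ψ, hks, hcoeff, hdom, hsuppψ⟩ := exists_class_data hM F r hr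
        have hsub : B.filter (fun e => (((e : Fin 2 →₀ ℕ) 0 % M, (e : Fin 2 →₀ ℕ) 1 % M) : ℕ × ℕ) = r) ⊆ Pin.filter (fun e => (((e : Fin 2 →₀ ℕ) 0 % M, (e : Fin 2 →₀ ℕ) 1 % M) : ℕ × ℕ) = r) := by
          intro e he
          rw [Finset.mem_filter] at he ⊢
          rw [hB, Finset.mem_filter] at he
          exact ⟨he.1.1, he.2⟩
        set Ls := (L.filter (fun l => (((l : Fin 2 →₀ ℕ) 0 % M, (l : Fin 2 →₀ ℕ) 1 % M) : ℕ × ℕ) = r ∧ s ≤ l)).image (fun l => (Finsupp.mapRange (· / M) (Nat.zero_div M) (l - s) : Fin 2 →₀ ℕ)) with hLs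
        have hclass := card_class_le hM F ψ C s r L hks hcoeff hdom
        have hassoc : ψ * C = (ψ * φ 0) * expand M C' := by rw [hCdef, mul_assoc]
        have hψbox : ∀ c ∈ ψ.support, c 0 < b ∧ c 1 < b := by
          intro c hc
          obtain ⟨h0, h1⟩ := hFbox _ (hsuppψ c hc)
          simp only [Finsupp.add_apply, Finsupp.smul_apply, smul_eq_mul] at h0 h1
          constructor
          · by_contra hc0; push Not at hc0
            have : b * M ≤ M * c 0 := by rw [mul_comm]; exact Nat.mul_le_mul_left M hc0
            omega
          · by_contra hc1; push Not at hc1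
            have : b * M ≤ M * c 1 := by rw [mul_comm]; exact Nat.mul_le_mul_left M hc1
            omega
        have hψcard : ψ.support.card ≤ b * b := Radix.card_le_of_box _ hψbox
        set F' : MvPolynomial (Fin 2) ℂ := ψ * φ 0 with hF'
        have hF'card : F'.support.card ≤ b * b * t := by
          calc F'.support.card ≤ (ψ.support + (φ 0).support).card := Finset.card_le_card (support_mul _ _)
            _ ≤ ψ.support.card * (φ 0).support.card := Finset.card_add_le
            _ ≤ b * b * t := Nat.mul_le_mul hψcard (hφt 0)
        have hF'box : ∀ e ∈ F'.support, e 0 < (b + q) * M ∧ e 1 < (b + q) * M := by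
          intro e he
          obtain ⟨c, hc, d, hd, rfl⟩ := Finset.mem_add.1 (support_mul _ _ he)
          obtain ⟨hc0, hc1⟩ := hψbox c hc
          obtain ⟨hd0, hd1⟩ := hφbox 0 d hd
          simp only [Finsupp.add_apply]
          have hb : b ≤ b * M := Nat.le_mul_of_pos_right _ hM
          have hbq : (b + q) * M = b * M + q * M := by ring
          rw [hbq]
          constructor
          · linarith
          · linarith
        have hIH := ih M q t (b * b * t) (b + q) F' (fun i => φ i.succ) Ls hM hF'card hF'box
          (fun i => hφ0 i.succ) (fun i => hφt i.succ) (fun i => hφbox i.succ)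
        have hLs_card : Ls.card ≤ (L.filter (fun l => (((l : Fin 2 →₀ ℕ) 0 % M, (l : Fin 2 →₀ ℕ) 1 % M) : ℕ × ℕ) = r)).card := by
          refine Finset.card_image_le.trans (Finset.card_le_card ?_)
          intro l hl
          rw [Finset.mem_filter] at hl ⊢
          exact ⟨hl.1, hl.2.1⟩
        calc (B.filter (fun e => (((e : Fin 2 →₀ ℕ) 0 % M, (e : Fin 2 →₀ ℕ) 1 % M) : ℕ × ℕ) = r)).card
            ≤ (Pin.filter (fun e => (((e : Fin 2 →₀ ℕ) 0 % M, (e : Fin 2 →₀ ℕ) 1 % M) : ℕ × ℕ) = r)).card := Finset.card_le_card hsub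
          _ ≤ ((Finset.filter (fun e : Fin 2 →₀ ℕ => ∃ w : Fin 2 → ℤ, 0 < w 0 ∧ 0 < w 1 ∧ ∀ q ∈ MvPolynomial.support (ψ * C), q ≠ e → ((w) 0 * ((q : Fin 2 →₀ ℕ) 0 : ℤ) + (w) 1 * ((q : Fin 2 →₀ ℕ) 1 : ℤ)) ≤ ((w) 0 * ((e : Fin 2 →₀ ℕ) 0 : ℤ) + (w) 1 * ((e : Fin 2 →₀ ℕ) 1 : ℤ)) → q ∈ ((Ls) : Finset (Fin 2 →₀ ℕ))) (MvPolynomial.support (ψ * C)))).card := hclass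
          _ = ((Finset.filter (fun e : Fin 2 →₀ ℕ => ∃ w : Fin 2 → ℤ, 0 < w 0 ∧ 0 < w 1 ∧ ∀ q ∈ MvPolynomial.support (F' * expand M C'), q ≠ e → ((w) 0 * ((q : Fin 2 →₀ ℕ) 0 : ℤ) + (w) 1 * ((q : Fin 2 →₀ ℕ) 1 : ℤ)) ≤ ((w) 0 * ((e : Fin 2 →₀ ℕ) 0 : ℤ) + (w) 1 * ((e : Fin 2 →₀ ℕ) 1 : ℤ)) → q ∈ ((Ls) : Finset (Fin 2 →₀ ℕ))) (MvPolynomial.support (F' * expand M C')))).card := by rw [hassoc]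
          _ ≤ b * b * t + Ls.card * (k * (b + q + k * q) ^ 2 * t) := hIH
          _ ≤ b * b * t + (L.filter (fun l => (((l : Fin 2 →₀ ℕ) 0 % M, (l : Fin 2 →₀ ℕ) 1 % M) : ℕ × ℕ) = r)).card * Y' := by
              rw [hY']; exact Nat.add_le_add_left (Nat.mul_le_mul_right _ hLs_card) _
      · -- no letter of class r: the fibre is empty
        have hempty : B.filter (fun e => (((e : Fin 2 →₀ ℕ) 0 % M, (e : Fin 2 →₀ ℕ) 1 % M) : ℕ × ℕ) = r) = ∅ := by
          rw [Finset.filter_eq_empty_iff]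
          intro e he hker
          rw [hB, Finset.mem_filter] at he
          have heP : e ∈ (F * expand M C).support := pinf_subset _ _ he.1
          obtain ⟨a, ha, hka, -⟩ := exists_letter_of_mem_support hM F C heP
          exact hr ⟨a, ha, hka.trans hker⟩
        rw [hempty, Finset.card_empty]
        exact Nat.zero_le _
    have hLsum : ∑ r ∈ Limg, (L.filter (fun l => (((l : Fin 2 →₀ ℕ) 0 % M, (l : Fin 2 →₀ ℕ) 1 % M) : ℕ × ℕ) = r)).card = L.card :=
      (Finset.card_eq_sum_card_fiberwise (fun l hl =>
        Finset.mem_coe.2 (Finset.mem_image_of_mem _ (Finset.mem_coe.1 hl)))).symm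
    have hLimg_card : Limg.card ≤ L.card := Finset.card_image_le
    have hBle : B.card ≤ L.card * (b * b * t) + L.card * Y' := by
      rw [hBsum]
      calc ∑ r ∈ Limg, (B.filter (fun e => (((e : Fin 2 →₀ ℕ) 0 % M, (e : Fin 2 →₀ ℕ) 1 % M) : ℕ × ℕ) = r)).card
          ≤ ∑ r ∈ Limg, (b * b * t + (L.filter (fun l => (((l : Fin 2 →₀ ℕ) 0 % M, (l : Fin 2 →₀ ℕ) 1 % M) : ℕ × ℕ) = r)).card * Y') := Finset.sum_le_sum hfibre
        _ = Limg.card * (b * b * t) + (∑ r ∈ Limg, (L.filter (fun l => (((l : Fin 2 →₀ ℕ) 0 % M, (l : Fin 2 →₀ ℕ) 1 % M) : ℕ × ℕ) = r)).card) * Y' := by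
            rw [Finset.sum_add_distrib, Finset.sum_const, smul_eq_mul, Finset.sum_mul]
        _ = Limg.card * (b * b * t) + L.card * Y' := by rw [hLsum]
        _ ≤ L.card * (b * b * t) + L.card * Y' := Nat.add_le_add_right (Nat.mul_le_mul_right _ hLimg_card) _
    have hY : b * b * t + Y' ≤ (k + 1) * (b + (k + 1) * q) ^ 2 * t := by
      have hsq : b * b ≤ (b + (k + 1) * q) ^ 2 := by
        rw [← pow_two]; exact Nat.pow_le_pow_left (Nat.le_add_right _ _) 2
      have hsq' : b * b * t ≤ (b + (k + 1) * q) ^ 2 * t := Nat.mul_le_mul_right t hsq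
      have heq : b + q + k * q = b + (k + 1) * q := by ring
      have hring : (k + 1) * (b + (k + 1) * q) ^ 2 * t =
          k * (b + (k + 1) * q) ^ 2 * t + (b + (k + 1) * q) ^ 2 * t := by ring
      rw [hY', heq, hring, Nat.add_comm]
      exact Nat.add_le_add_left hsq' _
    calc Pin.card = B.card + A.card := hsplit
      _ ≤ (L.card * (b * b * t) + L.card * Y') + T := Nat.add_le_add hBle hAle
      _ = T + L.card * (b * b * t + Y') := by ring
      _ ≤ T + L.card * ((k + 1) * (b + (k + 1) * q) ^ 2 * t) := Nat.add_le_add_left (Nat.mul_le_mul_left _ hY) _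

/-! ## The registered rung -/

/-- RUNG (lead c6, wave 2) — PINNED RIGID RADIX (n-uniform; stub 7g at `m = 0` on radix frames, AFFINE in `|L|`).  For `M ≥ 1`,
digit polynomials `φ_i` with constant terms `1`, `≤ t` monomials, exponents `< qM`, and ANY finite set `L` of exponents, the support
points `e` of `P = ∏_i expand (M^i) φ_i` admitting a positive weight for which every OTHER nonzero support point of `P` lighter
than or as light as `e` lies in `L` number at most `(|L|+1)(k³q²+1)(t+1)` (for `k ≥ 1` in fact `≤ t + (|L|+1)k³q²t`). -/
theorem stub_enginePinnedRadix : ∀ (k M q t : ℕ) (φ : Fin k → MvPolynomial (Fin 2) ℂ) (L : Finset (Fin 2 →₀ ℕ)), 1 ≤ M →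
    (∀ i, MvPolynomial.coeff 0 (φ i) = 1) → (∀ i, (φ i).support.card ≤ t) →
    (∀ i, ∀ e ∈ (φ i).support, e 0 < q * M ∧ e 1 < q * M) →
    {e : Fin 2 →₀ ℕ | e ∈ (∏ i : Fin k, MvPolynomial.expand (M ^ (i : ℕ)) (φ i)).support ∧ ∃ w : Fin 2 → ℤ, 0 < w 0 ∧ 0 < w 1 ∧
        ∀ q' ∈ (∏ i : Fin k, MvPolynomial.expand (M ^ (i : ℕ)) (φ i)).support, q' ≠ 0 → q' ≠ e →
          w 0 * (q' 0 : ℤ) + w 1 * (q' 1 : ℤ) ≤ w 0 * (e 0 : ℤ) + w 1 * (e 1 : ℤ) → q' ∈ L}.ncard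
      ≤ (L.card + 1) * (k ^ 3 * q ^ 2 + 1) * (t + 1) := by
  intro k M q t φ L hM hφ0 hφt hφbox
  set P : MvPolynomial (Fin 2) ℂ := ∏ i : Fin k, expand (M ^ (i : ℕ)) (φ i) with hP
  have hsub : {e : Fin 2 →₀ ℕ | e ∈ P.support ∧ ∃ w : Fin 2 → ℤ, 0 < w 0 ∧ 0 < w 1 ∧
        ∀ q' ∈ P.support, q' ≠ 0 → q' ≠ e →
          w 0 * (q' 0 : ℤ) + w 1 * (q' 1 : ℤ) ≤ w 0 * (e 0 : ℤ) + w 1 * (e 1 : ℤ) → q' ∈ L} ⊆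
      (((Finset.filter (fun e : Fin 2 →₀ ℕ => ∃ w : Fin 2 → ℤ, 0 < w 0 ∧ 0 < w 1 ∧ ∀ q ∈ MvPolynomial.support (P), q ≠ e → ((w) 0 * ((q : Fin 2 →₀ ℕ) 0 : ℤ) + (w) 1 * ((q : Fin 2 →₀ ℕ) 1 : ℤ)) ≤ ((w) 0 * ((e : Fin 2 →₀ ℕ) 0 : ℤ) + (w) 1 * ((e : Fin 2 →₀ ℕ) 1 : ℤ)) → q ∈ ((insert 0 L) : Finset (Fin 2 →₀ ℕ))) (MvPolynomial.support (P))) : Finset (Fin 2 →₀ ℕ)) : Set (Fin 2 →₀ ℕ)) := by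
    rintro e ⟨heP, w, hw0, hw1, hpin⟩
    rw [Finset.mem_coe]
    refine Finset.mem_filter.2 ⟨heP, w, hw0, hw1, ?_⟩
    intro q' hq' hne hle
    by_cases hq0 : q' = 0
    · rw [hq0]; exact Finset.mem_insert_self _ _
    · exact Finset.mem_insert_of_mem (hpin q' hq' hq0 hne hle)
  have hle1 : {e : Fin 2 →₀ ℕ | e ∈ P.support ∧ ∃ w : Fin 2 → ℤ, 0 < w 0 ∧ 0 < w 1 ∧
        ∀ q' ∈ P.support, q' ≠ 0 → q' ≠ e →
          w 0 * (q' 0 : ℤ) + w 1 * (q' 1 : ℤ) ≤ w 0 * (e 0 : ℤ) + w 1 * (e 1 : ℤ) → q' ∈ L}.ncard ≤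
      ((Finset.filter (fun e : Fin 2 →₀ ℕ => ∃ w : Fin 2 → ℤ, 0 < w 0 ∧ 0 < w 1 ∧ ∀ q ∈ MvPolynomial.support (P), q ≠ e → ((w) 0 * ((q : Fin 2 →₀ ℕ) 0 : ℤ) + (w) 1 * ((q : Fin 2 →₀ ℕ) 1 : ℤ)) ≤ ((w) 0 * ((e : Fin 2 →₀ ℕ) 0 : ℤ) + (w) 1 * ((e : Fin 2 →₀ ℕ) 1 : ℤ)) → q ∈ ((insert 0 L) : Finset (Fin 2 →₀ ℕ))) (MvPolynomial.support (P)))).card := by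
    calc _ ≤ ((((Finset.filter (fun e : Fin 2 →₀ ℕ => ∃ w : Fin 2 → ℤ, 0 < w 0 ∧ 0 < w 1 ∧ ∀ q ∈ MvPolynomial.support (P), q ≠ e → ((w) 0 * ((q : Fin 2 →₀ ℕ) 0 : ℤ) + (w) 1 * ((q : Fin 2 →₀ ℕ) 1 : ℤ)) ≤ ((w) 0 * ((e : Fin 2 →₀ ℕ) 0 : ℤ) + (w) 1 * ((e : Fin 2 →₀ ℕ) 1 : ℤ)) → q ∈ ((insert 0 L) : Finset (Fin 2 →₀ ℕ))) (MvPolynomial.support (P))) : Finset (Fin 2 →₀ ℕ)) : Set (Fin 2 →₀ ℕ))).ncard :=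
          Set.ncard_le_ncard hsub (Finset.finite_toSet _)
      _ = ((Finset.filter (fun e : Fin 2 →₀ ℕ => ∃ w : Fin 2 → ℤ, 0 < w 0 ∧ 0 < w 1 ∧ ∀ q ∈ MvPolynomial.support (P), q ≠ e → ((w) 0 * ((q : Fin 2 →₀ ℕ) 0 : ℤ) + (w) 1 * ((q : Fin 2 →₀ ℕ) 1 : ℤ)) ≤ ((w) 0 * ((e : Fin 2 →₀ ℕ) 0 : ℤ) + (w) 1 * ((e : Fin 2 →₀ ℕ) 1 : ℤ)) → q ∈ ((insert 0 L) : Finset (Fin 2 →₀ ℕ))) (MvPolynomial.support (P)))).card := Set.ncard_coe_finset _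
  refine hle1.trans ?_
  have hLins : (insert 0 L).card ≤ L.card + 1 := Finset.card_insert_le _ _
  cases k with
  | zero =>
    have hP1 : P = 1 := by rw [hP]; simp
    calc ((Finset.filter (fun e : Fin 2 →₀ ℕ => ∃ w : Fin 2 → ℤ, 0 < w 0 ∧ 0 < w 1 ∧ ∀ q ∈ MvPolynomial.support (P), q ≠ e → ((w) 0 * ((q : Fin 2 →₀ ℕ) 0 : ℤ) + (w) 1 * ((q : Fin 2 →₀ ℕ) 1 : ℤ)) ≤ ((w) 0 * ((e : Fin 2 →₀ ℕ) 0 : ℤ) + (w) 1 * ((e : Fin 2 →₀ ℕ) 1 : ℤ)) → q ∈ ((insert 0 L) : Finset (Fin 2 →₀ ℕ))) (MvPolynomial.support (P)))).card ≤ P.support.card := Finset.card_le_card (pinf_subset _ _)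
      _ ≤ 1 := by rw [hP1, MvPolynomial.support_one, Finset.card_singleton]
      _ ≤ (L.card + 1) * (0 ^ 3 * q ^ 2 + 1) * (t + 1) := by
          have : 1 ≤ (L.card + 1) * (0 ^ 3 * q ^ 2 + 1) * (t + 1) :=
            Nat.one_le_iff_ne_zero.2 (by positivity)
          exact this
  | succ k =>
    have hsplit : P = φ 0 * expand M (∏ i : Fin k, expand (M ^ (i : ℕ)) (φ i.succ)) := by
      rw [hP, Radix.prod_expand_succ]
    have hgen := genPin k M q t t q (φ 0) (fun i => φ i.succ) (insert 0 L) hM (hφt 0) (hφbox 0)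
      (fun i => hφ0 i.succ) (fun i => hφt i.succ) (fun i => hφbox i.succ)
    rw [hsplit]
    refine hgen.trans ?_
    have heq : q + k * q = (k + 1) * q := by ring
    rw [heq]
    have h1 : (insert 0 L).card * (k * ((k + 1) * q) ^ 2 * t) ≤ (L.card + 1) * (k * ((k + 1) * q) ^ 2 * t) :=
      Nat.mul_le_mul_right _ hLins
    have h2 : k * ((k + 1) * q) ^ 2 * t ≤ ((k + 1) ^ 3 * q ^ 2) * t := by
      have : k * ((k + 1) * q) ^ 2 ≤ (k + 1) ^ 3 * q ^ 2 := by
        have hk : k ≤ k + 1 := Nat.le_succ k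
        calc k * ((k + 1) * q) ^ 2 = k * ((k + 1) ^ 2 * q ^ 2) := by ring
          _ ≤ (k + 1) * ((k + 1) ^ 2 * q ^ 2) := Nat.mul_le_mul_right _ hk
          _ = (k + 1) ^ 3 * q ^ 2 := by ring
      exact Nat.mul_le_mul_right t this
    have h3 : t + (L.card + 1) * (((k + 1) ^ 3 * q ^ 2) * t) ≤ (L.card + 1) * ((k + 1) ^ 3 * q ^ 2 + 1) * (t + 1) := by
      set A := L.card + 1 with hAdef
      set K := (k + 1) ^ 3 * q ^ 2 with hKdef
      have hA : 1 ≤ A := by rw [hAdef]; exact Nat.le_add_left 1 _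
      have ht : t ≤ t + 1 := Nat.le_succ t
      calc t + A * (K * t) ≤ A * t + A * (K * t) := Nat.add_le_add_right (Nat.le_mul_of_pos_left t hA) _
        _ = A * (K + 1) * t := by ring
        _ ≤ A * (K + 1) * (t + 1) := Nat.mul_le_mul_left _ ht
    calc t + (insert 0 L).card * (k * ((k + 1) * q) ^ 2 * t)
        ≤ t + (L.card + 1) * (k * ((k + 1) * q) ^ 2 * t) := Nat.add_le_add_left h1 _
      _ ≤ t + (L.card + 1) * (((k + 1) ^ 3 * q ^ 2) * t) := Nat.add_le_add_left (Nat.mul_le_mul_left _ h2) _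
      _ ≤ (L.card + 1) * ((k + 1) ^ 3 * q ^ 2 + 1) * (t + 1) := h3

end

end Summit.ValiantsHypothesis.ValiantsHypothesis.Theorems.TwoProducts.PinnedRadix
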